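import Summits.KontsevichZagierPeriods.KontsevichZagierPeriods.Theorems.UnfoldedStokesStokesGenerationStubRungDlogProd
import Literature.NumberTheory.Transcendental.SemialgebraicAlgebraicPoints
import Mathlib.Topology.Algebra.Polynomial
import Mathlib.Analysis.Calculus.Deriv.Polynomial
import Mathlib.Analysis.Calculus.Deriv.Inv
import Mathlib.Analysis.Calculus.Deriv.Mul

/-!
# `StokesGeneration` (stmt-KontsevichZagierPeriods-3586) — line `fibrewise_stokes`, stub `stub_swapTransport`

Registered stub W1 (rung 6, the dlog-swap sector) of the line `fibrewise_stokes` of the crux `StokesGeneration`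
(route UnfoldedStokes): **the closed-form transport, on the 4-cube `[0,1]⁴` (coordinates `x₀, x₁`, homotopy
variable `y = x₂`, silent `x₃`), of the transposition relator `γ (p′(x₀)/p(x₀) − q′(x₁)/q(x₁))`**, for real
polynomials `p, q` with algebraic coefficients, positive on `[0,1]`, and a real algebraic `γ`.

With `ρ = p(x₀)/q(x₁) > 0` and the straight-line homotopy `ρ_y = 1 + y (ρ − 1) = N/q(x₁)`,
`N = (1 − y) q(x₁) + y p(x₀) > 0` (a convex combination of positives), the closed `1`-form
`d log ρ_y = a₀ dx₀ + a₁ dx₁ + b dy` has `a₀ + a₁ = (y p′(x₀) + (1 − y) q′(x₁))/N − q′(x₁)/q(x₁)` and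
`b = (p(x₀) − q(x₁))/N`. Three fibrewise primitives, in the directions `![2, 0, 1]`:
* `G₀ = γ (y p′/p + (1 − y) q′/q − (y p′ + (1 − y) q′)/N)` along `y`, fibre derivative
  `D₀ = γ (p′/p − q′/q − (p′ q − q′ p)/N²)`; BOTH boundary values vanish (`N|_{y=1} = p(x₀)`, `N|_{y=0} = q(x₁)`);
* `G₁ = γ b = γ (p − q)/N` along `x₀`, `D₁ = γ p′ q/N²`, boundary values `γ (p(c) − q(x₁))/((1 − y) q(x₁) + y p(c))`;
* `G₂ = γ b` along `x₁`, `D₂ = −γ q′ p/N²`, boundary values `γ (p(x₀) − q(c))/((1 − y) q(c) + y p(x₀))` (`c = 1, 0`).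
Since `D₀ + D₁ + D₂ = γ (p′/p − q′/q)`, the relator is the sum of the three fibrewise Stokes elements
`Dⱼ − (Gⱼ|₁ − Gⱼ|₀)` plus the four boundary leftovers, which the statement records in the ratio form
`(p(1)/q(x₁) − 1)/(1 + y (p(1)/q(x₁) − 1)) = (p(1) − q(x₁))/((1 − y) q(x₁) + y p(1))` (numerator and denominator
multiplied by `q(x₁) > 0`), etc. Everything is a rational function, with non-vanishing denominators on the cube,
of the coordinates, of the algebraic-coefficient polynomials `p, q, p′, q′` read on one coordinate, and of the
algebraic constants `γ, p(0), p(1), q(0), q(1)`: `ℚ`-semialgebraic (Bochnak–Coste–Roy, Prop. 2.2.6; real-algebraic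
constants are `ℚ`-semialgebraic, Kontsevich–Zagier §1.1) and continuous on the compact cube, hence bounded and
integrable; there is no kink set.

References: M. Kontsevich, D. Zagier, *Periods* (2001), §1.1–1.2; J. Ayoub, *Une version relative de la conjecture
des périodes de Kontsevich–Zagier*, Ann. of Math. 181 (2015), Rem. 1.5; J. Bochnak, M. Coste, M.-F. Roy, *Real
Algebraic Geometry* (1998), Prop. 2.2.6.
-/

noncomputable section

-- `Summit.KontsevichZagierPeriods.KontsevichZagierPeriods.…` is the tree's mandated layout (single-conjunct summit).
set_option linter.dupNamespace false

namespace Summit.KontsevichZagierPeriods.KontsevichZagierPeriods.Cruxes.StokesGeneration.FibrewiseStokes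

open MeasureTheory Set
open Literature.NumberTheory.Transcendental
open Literature.NumberTheory.Transcendental.KZ
open Literature.ModelTheory.ExponentialFields (IsSemialgebraic)

/-! ## Elementary algebra -/

/-- A convex combination `(1 − t) b + t a` of two positive reals, `t ∈ [0,1]`, is positive.
[folklore] -/
theorem swapTr_combo_pos {a b t : ℝ} (ha : 0 < a) (hb : 0 < b) (ht : t ∈ Set.Icc (0:ℝ) 1) :
    0 < (1 - t) * b + t * a := by
  rcases le_total b a with h | h
  · nlinarith [mul_nonneg ht.1 (sub_nonneg.2 h)]
  · nlinarith [mul_nonneg (sub_nonneg.2 ht.2) (sub_nonneg.2 h)]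

/-- The boundary leftovers in ratio form: `(a/b − 1)/(1 + t (a/b − 1)) = (a − b)/((1 − t) b + t a)`
for `b ≠ 0` (numerator and denominator multiplied by `b`). [folklore] -/
theorem swapTr_ratio {a b : ℝ} (t : ℝ) (hb : b ≠ 0) :
    (a / b - 1) / (1 + t * (a / b - 1)) = (a - b) / ((1 - t) * b + t * a) := by
  have h1 : a / b - 1 = (a - b) / b := by rw [sub_div, div_self hb]
  have h2 : 1 + t * ((a - b) / b) = ((1 - t) * b + t * a) / b := by
    field_simp
    ring
  rw [h1, h2, div_div_div_cancel_right₀ hb]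

/-! ## Calculus of the three primitives along their fibres -/

/-- Direction `y = x₂` (the homotopy variable): for constants `A, B, a, b, P, Q`,
`d/du [γ (u A + (1 − u) B − (u a + (1 − u) b)/((1 − u) Q + u P))]
  = γ (A − B − (a Q − b P)/((1 − u) Q + u P)²)`
wherever the denominator does not vanish (quotient rule, and
`(a − b)((1 − u) Q + u P) − (u a + (1 − u) b)(P − Q) = a Q − b P`). [folklore] -/
theorem swapTr_hasDerivAt_dir2 {γ A B a b P Q s : ℝ} (hN : (1 - s) * Q + s * P ≠ 0) :
    HasDerivAt (fun u : ℝ =>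
        γ * (u * A + (1 - u) * B - (u * a + (1 - u) * b) / ((1 - u) * Q + u * P)))
      (γ * (A - B - (a * Q - b * P) / ((1 - s) * Q + s * P) ^ 2)) s := by
  have hl : ∀ c d : ℝ, HasDerivAt (fun u : ℝ => u * c + (1 - u) * d) (1 * c + (0 - 1) * d) s :=
    fun c d => ((hasDerivAt_id' s).mul_const c).fun_add
      (((hasDerivAt_const s (1:ℝ)).fun_sub (hasDerivAt_id' s)).mul_const d)
  have hden : HasDerivAt (fun u : ℝ => (1 - u) * Q + u * P) ((0 - 1) * Q + 1 * P) s :=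
    (((hasDerivAt_const s (1:ℝ)).fun_sub (hasDerivAt_id' s)).mul_const Q).fun_add
      ((hasDerivAt_id' s).mul_const P)
  refine (((hl A B).fun_sub ((hl a b).fun_div hden hN)).const_mul γ).congr_deriv ?_
  ring

/-- Direction `x₀`: `d/du [γ (p(u) − Q)/((1 − y) Q + y p(u))] = γ p′(u) Q/((1 − y) Q + y p(u))²`
wherever the denominator does not vanish (quotient rule). [folklore] -/
theorem swapTr_hasDerivAt_dir0 (p : Polynomial ℝ) {γ Q y s : ℝ}
    (hN : (1 - y) * Q + y * p.eval s ≠ 0) :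
    HasDerivAt (fun u : ℝ => γ * (p.eval u - Q) / ((1 - y) * Q + y * p.eval u))
      (γ * (Polynomial.derivative p).eval s * Q / ((1 - y) * Q + y * p.eval s) ^ 2) s := by
  refine ((((p.hasDerivAt s).sub_const Q).const_mul γ).fun_div
    (((p.hasDerivAt s).const_mul y).const_add ((1 - y) * Q)) hN).congr_deriv ?_
  ring

/-- Direction `x₁`: `d/du [γ (P − q(u))/((1 − y) q(u) + y P)] = −γ q′(u) P/((1 − y) q(u) + y P)²`
wherever the denominator does not vanish (quotient rule). [folklore] -/
theorem swapTr_hasDerivAt_dir1 (q : Polynomial ℝ) {γ P y s : ℝ}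
    (hN : (1 - y) * q.eval s + y * P ≠ 0) :
    HasDerivAt (fun u : ℝ => γ * (P - q.eval u) / ((1 - y) * q.eval u + y * P))
      (-(γ * (Polynomial.derivative q).eval s * P) / ((1 - y) * q.eval s + y * P) ^ 2) s := by
  refine ((((q.hasDerivAt s).const_sub P).const_mul γ).fun_div
    (((q.hasDerivAt s).const_mul (1 - y)).add_const (y * P)) hN).congr_deriv ?_
  ring

/-! ## The transport -/

/-- **Registered stub `stub_swapTransport` (rung 6, W1): closed-form transport of the dlog-swap
relator on the 4-cube.** For real polynomials `p, q` with algebraic coefficients, positive on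
`[0,1]`, and real algebraic `γ`, the relator `γ (p′(x₀)/p(x₀) − q′(x₁)/q(x₁))` equals, on `[0,1]⁴`,
the sum of three fibrewise Stokes elements `Dⱼ − (Gⱼ|₁ − Gⱼ|₀)` in the directions `![2, 0, 1]`
(primitives `G₀ = γ (y p′/p + (1 − y) q′/q − (y p′ + (1 − y) q′)/N)`, `G₁ = G₂ = γ (p − q)/N`,
`N = (1 − y) q(x₁) + y p(x₀)`, `y = x₂`), minus the four boundary leftovers of `G₁, G₂` on the
faces `x₀ = 1, 0` and `x₁ = 1, 0` (in ratio form); all data `ℚ`-semialgebraic, continuous on the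
closed cube, no kink set. [cite: Ayoub2015, Rem. 1.5] -/
theorem stub_swapTransport :
    ∀ (γ : ℝ) (p q : Polynomial ℝ), IsAlgebraic ℚ γ → (∀ n, IsAlgebraic ℚ (p.coeff n)) →
      (∀ n, IsAlgebraic ℚ (q.coeff n)) → (∀ u ∈ Set.Icc (0:ℝ) 1, 0 < p.eval u) → (∀ u ∈ Set.Icc (0:ℝ) 1, 0 < q.eval u) →
      ∃ (G D : Fin 3 → (Fin 4 → ℝ) → ℝ) (r : Fin 3 → IntegralRep 4),
        (∀ j, IsSemialgebraicFunOn ℚ (Set.pi Set.univ (fun _ : Fin 4 => Set.Icc (0:ℝ) 1)) (G j) ∧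
          IsSemialgebraicFunOn ℚ (Set.pi Set.univ (fun _ : Fin 4 => Set.Icc (0:ℝ) 1)) (D j) ∧
          (∃ B : ℝ, ∀ x ∈ Set.pi Set.univ (fun _ : Fin 4 => Set.Icc (0:ℝ) 1), |(G j) x| ≤ B) ∧
          (∀ x ∈ Set.pi Set.univ (fun _ : Fin 4 => Set.Icc (0:ℝ) 1),
            ContinuousOn (fun s : ℝ => (G j) (Function.update x ((![2, 0, 1] : Fin 3 → Fin 4) j) s)) (Set.Icc (0:ℝ) 1)) ∧
          (∀ x ∈ Set.pi Set.univ (fun _ : Fin 4 => Set.Icc (0:ℝ) 1), x ((![2, 0, 1] : Fin 3 → Fin 4) j) ∈ Set.Ioo (0:ℝ) 1 →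
            HasDerivAt (fun s : ℝ => (G j) (Function.update x ((![2, 0, 1] : Fin 3 → Fin 4) j) s)) ((D j) x)
              (x ((![2, 0, 1] : Fin 3 → Fin 4) j)))) ∧
        (∀ j, (r j).domain = Set.pi Set.univ (fun _ : Fin 4 => Set.Icc (0:ℝ) 1) ∧
          ∀ x ∈ Set.pi Set.univ (fun _ : Fin 4 => Set.Icc (0:ℝ) 1), (r j).integrand x =
            D j x - (G j (Function.update x ((![2, 0, 1] : Fin 3 → Fin 4) j) 1) -
              G j (Function.update x ((![2, 0, 1] : Fin 3 → Fin 4) j) 0))) ∧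
        ∀ x ∈ Set.pi Set.univ (fun _ : Fin 4 => Set.Icc (0:ℝ) 1), ∑ j, (r j).integrand x =
          γ * ((Polynomial.derivative p).eval (x 0) / p.eval (x 0) - (Polynomial.derivative q).eval (x 1) / q.eval (x 1)) -
          γ * ((p.eval 1 / q.eval (x 1) - 1) / (1 + x 2 * (p.eval 1 / q.eval (x 1) - 1)) -
                (p.eval 0 / q.eval (x 1) - 1) / (1 + x 2 * (p.eval 0 / q.eval (x 1) - 1))) -
          γ * ((p.eval (x 0) / q.eval 1 - 1) / (1 + x 2 * (p.eval (x 0) / q.eval 1 - 1)) -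
                (p.eval (x 0) / q.eval 0 - 1) / (1 + x 2 * (p.eval (x 0) / q.eval 0 - 1))) := by
  intro γ p q hγ hp hq hppos hqpos
  -- the closed 4-cube and what holds on it
  set S : Set (Fin 4 → ℝ) := Set.pi Set.univ (fun _ : Fin 4 => Set.Icc (0:ℝ) 1) with hS
  have hSsa : IsSemialgebraic ℚ S := by rw [hS, ← cube_eq_pi]; exact isSemialgebraic_cube
  have hSc : IsCompact S := isCompact_univ_pi fun _ => isCompact_Icc
  have h02 : (0 : Fin 4) ≠ 2 := by decide
  have h12 : (1 : Fin 4) ≠ 2 := by decide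
  have h10 : (1 : Fin 4) ≠ 0 := by decide
  have h20 : (2 : Fin 4) ≠ 0 := by decide
  have h01 : (0 : Fin 4) ≠ 1 := by decide
  have h21 : (2 : Fin 4) ≠ 1 := by decide
  have hmem : ∀ x ∈ S, ∀ i, x i ∈ Set.Icc (0:ℝ) 1 := fun x hx i => (Set.mem_univ_pi.mp hx) i
  have h0I : (0:ℝ) ∈ Set.Icc (0:ℝ) 1 := ⟨le_rfl, zero_le_one⟩
  have h1I : (1:ℝ) ∈ Set.Icc (0:ℝ) 1 := ⟨zero_le_one, le_rfl⟩
  have hcS : ∀ c ∈ Set.Icc (0:ℝ) 1, (fun _ => c : Fin 4 → ℝ) ∈ S := fun c hc =>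
    Set.mem_univ_pi.mpr fun _ => hc
  -- moving one coordinate inside `[0,1]` stays in the cube
  have hupd : ∀ x ∈ S, ∀ (i : Fin 4), ∀ s ∈ Set.Icc (0:ℝ) 1, Function.update x i s ∈ S := by
    intro x hx i s hs
    refine Set.mem_univ_pi.mpr fun l => ?_
    rcases eq_or_ne l i with rfl | hli
    · simpa using hs
    · rw [Function.update_of_ne hli]
      exact hmem x hx l
  -- positivity: `p(x₀), q(x₁) > 0` and the convex combinations `(1 - y) B + y A > 0`
  have hPne : ∀ x ∈ S, p.eval (x 0) ≠ 0 := fun x hx => (hppos _ (hmem x hx 0)).ne'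
  have hQne : ∀ x ∈ S, q.eval (x 1) ≠ 0 := fun x hx => (hqpos _ (hmem x hx 1)).ne'
  have hNne : ∀ x ∈ S, (1 - x 2) * q.eval (x 1) + x 2 * p.eval (x 0) ≠ 0 := fun x hx =>
    (swapTr_combo_pos (hppos _ (hmem x hx 0)) (hqpos _ (hmem x hx 1)) (hmem x hx 2)).ne'
  have hN2ne : ∀ x ∈ S, ((1 - x 2) * q.eval (x 1) + x 2 * p.eval (x 0)) ^ 2 ≠ 0 := fun x hx =>
    pow_ne_zero 2 (hNne x hx)
  have hMne : ∀ c ∈ Set.Icc (0:ℝ) 1, ∀ x ∈ S, (1 - x 2) * q.eval (x 1) + x 2 * p.eval c ≠ 0 :=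
    fun c hc x hx => (swapTr_combo_pos (hppos c hc) (hqpos _ (hmem x hx 1)) (hmem x hx 2)).ne'
  have hKne : ∀ c ∈ Set.Icc (0:ℝ) 1, ∀ x ∈ S, (1 - x 2) * q.eval c + x 2 * p.eval (x 0) ≠ 0 :=
    fun c hc x hx => (swapTr_combo_pos (hppos _ (hmem x hx 0)) (hqpos c hc) (hmem x hx 2)).ne'
  -- semialgebraic atoms on the cube (BCR Prop. 2.2.6; KZ §1.1 for the algebraic constants)
  have hysa : IsSemialgebraicFunOn ℚ S (fun x => x 2) := isSemialgebraicFunOn_apply hSsa 2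
  have hγsa : IsSemialgebraicFunOn ℚ S (fun _ => γ) :=
    isSemialgebraicFunOn_const_of_isAlgebraic hSsa hγ
  have h1sa : IsSemialgebraicFunOn ℚ S (fun _ => (1:ℝ)) :=
    isSemialgebraicFunOn_const_of_isAlgebraic hSsa isAlgebraic_one
  have h1ysa : IsSemialgebraicFunOn ℚ S (fun x => 1 - x 2) := h1sa.fun_sub hysa
  have hPsa : IsSemialgebraicFunOn ℚ S (fun x => p.eval (x 0)) :=
    isSemialgebraicFunOn_eval_apply hSsa hp 0
  have hQsa : IsSemialgebraicFunOn ℚ S (fun x => q.eval (x 1)) :=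
    isSemialgebraicFunOn_eval_apply hSsa hq 1
  have hP'sa : IsSemialgebraicFunOn ℚ S (fun x => (Polynomial.derivative p).eval (x 0)) :=
    isSemialgebraicFunOn_eval_apply hSsa (isAlgebraic_coeff_derivative hp) 0
  have hQ'sa : IsSemialgebraicFunOn ℚ S (fun x => (Polynomial.derivative q).eval (x 1)) :=
    isSemialgebraicFunOn_eval_apply hSsa (isAlgebraic_coeff_derivative hq) 1
  have hNsa : IsSemialgebraicFunOn ℚ S (fun x => (1 - x 2) * q.eval (x 1) + x 2 * p.eval (x 0)) :=
    (h1ysa.fun_mul hQsa).fun_add (hysa.fun_mul hPsa)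
  have hpc : ∀ c ∈ Set.Icc (0:ℝ) 1, IsAlgebraic ℚ c →
      IsSemialgebraicFunOn ℚ S (fun _ => p.eval c) := fun c hc hca =>
    isSemialgebraicFunOn_const_of_isAlgebraic hSsa (hPsa.isAlgebraic_apply (hcS c hc) fun _ => hca)
  have hqc : ∀ c ∈ Set.Icc (0:ℝ) 1, IsAlgebraic ℚ c →
      IsSemialgebraicFunOn ℚ S (fun _ => q.eval c) := fun c hc hca =>
    isSemialgebraicFunOn_const_of_isAlgebraic hSsa (hQsa.isAlgebraic_apply (hcS c hc) fun _ => hca)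
  -- the transport quotient `γ (A - B)/((1 - y) B + y A)`
  have hquot : ∀ {A B : (Fin 4 → ℝ) → ℝ}, IsSemialgebraicFunOn ℚ S A → IsSemialgebraicFunOn ℚ S B →
      (∀ x ∈ S, (1 - x 2) * B x + x 2 * A x ≠ 0) →
      IsSemialgebraicFunOn ℚ S (fun x => γ * (A x - B x) / ((1 - x 2) * B x + x 2 * A x)) :=
    fun hA hB hne => (hγsa.fun_mul (hA.fun_sub hB)).div ((h1ysa.fun_mul hB).fun_add (hysa.fun_mul hA)) hne
  -- continuity atoms on the cube
  have hyS : ContinuousOn (fun x : Fin 4 → ℝ => x 2) S := (continuous_apply 2).continuousOn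
  have h1yS : ContinuousOn (fun x : Fin 4 → ℝ => 1 - x 2) S := continuousOn_const.fun_sub hyS
  have hPS : ContinuousOn (fun x : Fin 4 → ℝ => p.eval (x 0)) S :=
    (p.continuous.comp (continuous_apply 0)).continuousOn
  have hQS : ContinuousOn (fun x : Fin 4 → ℝ => q.eval (x 1)) S :=
    (q.continuous.comp (continuous_apply 1)).continuousOn
  have hP'S : ContinuousOn (fun x : Fin 4 → ℝ => (Polynomial.derivative p).eval (x 0)) S :=
    ((Polynomial.derivative p).continuous.comp (continuous_apply 0)).continuousOn
  have hQ'S : ContinuousOn (fun x : Fin 4 → ℝ => (Polynomial.derivative q).eval (x 1)) S :=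
    ((Polynomial.derivative q).continuous.comp (continuous_apply 1)).continuousOn
  have hNS : ContinuousOn (fun x : Fin 4 → ℝ => (1 - x 2) * q.eval (x 1) + x 2 * p.eval (x 0)) S :=
    (h1yS.fun_mul hQS).fun_add (hyS.fun_mul hPS)
  have hN2S : ContinuousOn (fun x : Fin 4 → ℝ =>
      ((1 - x 2) * q.eval (x 1) + x 2 * p.eval (x 0)) ^ 2) S := hNS.pow 2
  have hquotS : ∀ {A B : (Fin 4 → ℝ) → ℝ}, ContinuousOn A S → ContinuousOn B S →
      (∀ x ∈ S, (1 - x 2) * B x + x 2 * A x ≠ 0) →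
      ContinuousOn (fun x => γ * (A x - B x) / ((1 - x 2) * B x + x 2 * A x)) S :=
    fun hA hB hne => (continuousOn_const.fun_mul (hA.fun_sub hB)).div₀
      ((h1yS.fun_mul hB).fun_add (hyS.fun_mul hA)) hne
  -- the witnesses
  set G0 : (Fin 4 → ℝ) → ℝ := fun x =>
    γ * (x 2 * ((Polynomial.derivative p).eval (x 0) / p.eval (x 0)) +
      (1 - x 2) * ((Polynomial.derivative q).eval (x 1) / q.eval (x 1)) -
      (x 2 * (Polynomial.derivative p).eval (x 0) + (1 - x 2) * (Polynomial.derivative q).eval (x 1)) /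
        ((1 - x 2) * q.eval (x 1) + x 2 * p.eval (x 0))) with hG0
  set D0 : (Fin 4 → ℝ) → ℝ := fun x =>
    γ * ((Polynomial.derivative p).eval (x 0) / p.eval (x 0) -
      (Polynomial.derivative q).eval (x 1) / q.eval (x 1) -
      ((Polynomial.derivative p).eval (x 0) * q.eval (x 1) -
          (Polynomial.derivative q).eval (x 1) * p.eval (x 0)) /
        ((1 - x 2) * q.eval (x 1) + x 2 * p.eval (x 0)) ^ 2) with hD0
  set G1 : (Fin 4 → ℝ) → ℝ := fun x =>
    γ * (p.eval (x 0) - q.eval (x 1)) / ((1 - x 2) * q.eval (x 1) + x 2 * p.eval (x 0)) with hG1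
  set D1 : (Fin 4 → ℝ) → ℝ := fun x =>
    γ * (Polynomial.derivative p).eval (x 0) * q.eval (x 1) /
      ((1 - x 2) * q.eval (x 1) + x 2 * p.eval (x 0)) ^ 2 with hD1
  set D2 : (Fin 4 → ℝ) → ℝ := fun x =>
    -(γ * (Polynomial.derivative q).eval (x 1) * p.eval (x 0)) /
      ((1 - x 2) * q.eval (x 1) + x 2 * p.eval (x 0)) ^ 2 with hD2
  -- the boundary leftovers of `G₁` on `x₀ = 1, 0` and of `G₂ = G₁` on `x₁ = 1, 0`
  set B1 : (Fin 4 → ℝ) → ℝ := fun x =>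
    γ * (p.eval 1 - q.eval (x 1)) / ((1 - x 2) * q.eval (x 1) + x 2 * p.eval 1) -
      γ * (p.eval 0 - q.eval (x 1)) / ((1 - x 2) * q.eval (x 1) + x 2 * p.eval 0) with hB1
  set B2 : (Fin 4 → ℝ) → ℝ := fun x =>
    γ * (p.eval (x 0) - q.eval 1) / ((1 - x 2) * q.eval 1 + x 2 * p.eval (x 0)) -
      γ * (p.eval (x 0) - q.eval 0) / ((1 - x 2) * q.eval 0 + x 2 * p.eval (x 0)) with hB2
  set I1 : (Fin 4 → ℝ) → ℝ := fun x => D1 x - B1 x with hI1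
  set I2 : (Fin 4 → ℝ) → ℝ := fun x => D2 x - B2 x with hI2
  -- semialgebraicity (closure under field operations, BCR Prop. 2.2.6)
  have hG0sa : IsSemialgebraicFunOn ℚ S G0 :=
    hγsa.fun_mul (((hysa.fun_mul (hP'sa.div hPsa hPne)).fun_add
      (h1ysa.fun_mul (hQ'sa.div hQsa hQne))).fun_sub
        (((hysa.fun_mul hP'sa).fun_add (h1ysa.fun_mul hQ'sa)).div hNsa hNne))
  have hD0sa : IsSemialgebraicFunOn ℚ S D0 :=
    hγsa.fun_mul (((hP'sa.div hPsa hPne).fun_sub (hQ'sa.div hQsa hQne)).fun_sub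
      (((hP'sa.fun_mul hQsa).fun_sub (hQ'sa.fun_mul hPsa)).div (hNsa.fun_pow 2) hN2ne))
  have hG1sa : IsSemialgebraicFunOn ℚ S G1 := hquot hPsa hQsa hNne
  have hD1sa : IsSemialgebraicFunOn ℚ S D1 := ((hγsa.fun_mul hP'sa).fun_mul hQsa).div (hNsa.fun_pow 2) hN2ne
  have hD2sa : IsSemialgebraicFunOn ℚ S D2 :=
    ((hγsa.fun_mul hQ'sa).fun_mul hPsa).fun_neg.div (hNsa.fun_pow 2) hN2ne
  have hI1sa : IsSemialgebraicFunOn ℚ S I1 := hD1sa.fun_sub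
    ((hquot (hpc 1 h1I isAlgebraic_one) hQsa (hMne 1 h1I)).fun_sub
      (hquot (hpc 0 h0I isAlgebraic_zero) hQsa (hMne 0 h0I)))
  have hI2sa : IsSemialgebraicFunOn ℚ S I2 := hD2sa.fun_sub
    ((hquot hPsa (hqc 1 h1I isAlgebraic_one) (hKne 1 h1I)).fun_sub
      (hquot hPsa (hqc 0 h0I isAlgebraic_zero) (hKne 0 h0I)))
  -- continuity on the cube
  have hG0c : ContinuousOn G0 S :=
    continuousOn_const.fun_mul (((hyS.fun_mul (hP'S.div₀ hPS hPne)).fun_add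
      (h1yS.fun_mul (hQ'S.div₀ hQS hQne))).fun_sub
        (((hyS.fun_mul hP'S).fun_add (h1yS.fun_mul hQ'S)).div₀ hNS hNne))
  have hD0c : ContinuousOn D0 S :=
    continuousOn_const.fun_mul (((hP'S.div₀ hPS hPne).fun_sub (hQ'S.div₀ hQS hQne)).fun_sub
      (((hP'S.fun_mul hQS).fun_sub (hQ'S.fun_mul hPS)).div₀ hN2S hN2ne))
  have hG1c : ContinuousOn G1 S := hquotS hPS hQS hNne
  have hD1c : ContinuousOn D1 S := ((continuousOn_const.fun_mul hP'S).fun_mul hQS).div₀ hN2S hN2ne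
  have hD2c : ContinuousOn D2 S := ((continuousOn_const.fun_mul hQ'S).fun_mul hPS).fun_neg.div₀ hN2S hN2ne
  have hI1c : ContinuousOn I1 S := hD1c.fun_sub
    ((hquotS continuousOn_const hQS (hMne 1 h1I)).fun_sub
      (hquotS continuousOn_const hQS (hMne 0 h0I)))
  have hI2c : ContinuousOn I2 S := hD2c.fun_sub
    ((hquotS hPS continuousOn_const (hKne 1 h1I)).fun_sub
      (hquotS hPS continuousOn_const (hKne 0 h0I)))
  -- packaged as `Fin 3`-families (`G₂ = G₁`)
  set G : Fin 3 → (Fin 4 → ℝ) → ℝ := ![G0, G1, G1] with hG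
  set D : Fin 3 → (Fin 4 → ℝ) → ℝ := ![D0, D1, D2] with hD
  set I : Fin 3 → (Fin 4 → ℝ) → ℝ := ![D0, I1, I2] with hI
  have hGsa : ∀ j, IsSemialgebraicFunOn ℚ S (G j) := fun j => by
    fin_cases j; exacts [hG0sa, hG1sa, hG1sa]
  have hDsa : ∀ j, IsSemialgebraicFunOn ℚ S (D j) := fun j => by
    fin_cases j; exacts [hD0sa, hD1sa, hD2sa]
  have hIsa : ∀ j, IsSemialgebraicFunOn ℚ S (I j) := fun j => by
    fin_cases j; exacts [hD0sa, hI1sa, hI2sa]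
  have hGc : ∀ j, ContinuousOn (G j) S := fun j => by fin_cases j; exacts [hG0c, hG1c, hG1c]
  have hIc : ∀ j, ContinuousOn (I j) S := fun j => by fin_cases j; exacts [hD0c, hI1c, hI2c]
  -- boundary values: `G₀` vanishes on `y = 1` (`N = p(x₀)`) and on `y = 0` (`N = q(x₁)`)
  have hG0_one : ∀ x, G0 (Function.update x 2 1) = 0 := fun x => by
    simp only [hG0, Function.update_self, Function.update_of_ne h02, Function.update_of_ne h12]
    ring
  have hG0_zero : ∀ x, G0 (Function.update x 2 0) = 0 := fun x => by
    simp only [hG0, Function.update_self, Function.update_of_ne h02, Function.update_of_ne h12]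
    ring
  -- boundary values of `G₁` on the faces `x₀ = c` and `x₁ = c`
  have hG1_x0 : ∀ c x, G1 (Function.update x 0 c) =
      γ * (p.eval c - q.eval (x 1)) / ((1 - x 2) * q.eval (x 1) + x 2 * p.eval c) := fun c x => by
    simp only [hG1, Function.update_self, Function.update_of_ne h10, Function.update_of_ne h20]
  have hG1_x1 : ∀ c x, G1 (Function.update x 1 c) =
      γ * (p.eval (x 0) - q.eval c) / ((1 - x 2) * q.eval c + x 2 * p.eval (x 0)) := fun c x => by
    simp only [hG1, Function.update_self, Function.update_of_ne h01, Function.update_of_ne h21]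
  -- bounds on the compact cube
  have hGbd : ∀ j, ∃ B : ℝ, ∀ x ∈ S, |G j x| ≤ B := fun j => by
    obtain ⟨B, hB⟩ := hSc.exists_bound_of_continuousOn (hGc j)
    exact ⟨B, fun x hx => by simpa only [Real.norm_eq_abs] using hB x hx⟩
  -- continuity along closed fibres
  have hGfib : ∀ j, ∀ x ∈ S, ContinuousOn
      (fun s : ℝ => G j (Function.update x ((![2, 0, 1] : Fin 3 → Fin 4) j) s)) (Set.Icc (0:ℝ) 1) := by
    intro j x hx
    have hc : Continuous fun s : ℝ => Function.update x ((![2, 0, 1] : Fin 3 → Fin 4) j) s :=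
      continuous_const.update _ continuous_id
    exact (hGc j).comp hc.continuousOn fun s hs => hupd x hx _ s hs
  -- derivatives along the fibres
  have hGder : ∀ j, ∀ x ∈ S, x ((![2, 0, 1] : Fin 3 → Fin 4) j) ∈ Set.Ioo (0:ℝ) 1 →
      HasDerivAt (fun s : ℝ => G j (Function.update x ((![2, 0, 1] : Fin 3 → Fin 4) j) s)) (D j x)
        (x ((![2, 0, 1] : Fin 3 → Fin 4) j)) := by
    intro j
    fin_cases j <;> intro x hx _
    · -- element `0`, along `y = x 2`
      show HasDerivAt (fun s : ℝ => G0 (Function.update x 2 s)) (D0 x) (x 2)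
      have hfun : ∀ s, G0 (Function.update x 2 s) =
          γ * (s * ((Polynomial.derivative p).eval (x 0) / p.eval (x 0)) +
            (1 - s) * ((Polynomial.derivative q).eval (x 1) / q.eval (x 1)) -
            (s * (Polynomial.derivative p).eval (x 0) + (1 - s) * (Polynomial.derivative q).eval (x 1)) /
              ((1 - s) * q.eval (x 1) + s * p.eval (x 0))) := fun s => by
        simp only [hG0, Function.update_self, Function.update_of_ne h02, Function.update_of_ne h12]
      simp only [hfun]
      exact swapTr_hasDerivAt_dir2 (hNne x hx)
    · -- element `1`, along `x 0`
      show HasDerivAt (fun s : ℝ => G1 (Function.update x 0 s)) (D1 x) (x 0)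
      simp only [hG1_x0]
      exact swapTr_hasDerivAt_dir0 p (hNne x hx)
    · -- element `2` (`G₂ = G₁`), along `x 1`
      show HasDerivAt (fun s : ℝ => G1 (Function.update x 1 s)) (D2 x) (x 1)
      simp only [hG1_x1]
      exact swapTr_hasDerivAt_dir1 q (hNne x hx)
  -- the three closed-cube representations
  let r : Fin 3 → IntegralRep 4 := fun j =>
    { domain := S
      integrand := I j
      isSemialgebraic_domain := hSsa
      isSemialgebraicFunOn_integrand := hIsa j
      integrableOn := (hIc j).integrableOn_compact hSc }
  refine ⟨G, D, r, fun j => ⟨hGsa j, hDsa j, hGbd j, hGfib j, hGder j⟩, ?_, fun x hx => ?_⟩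
  · -- the integrand clauses
    intro j
    fin_cases j <;> refine ⟨rfl, fun x _ => ?_⟩
    · show D0 x = D0 x - (G0 (Function.update x 2 1) - G0 (Function.update x 2 0))
      rw [hG0_one, hG0_zero, sub_zero, sub_zero]
    · show I1 x = D1 x - (G1 (Function.update x 0 1) - G1 (Function.update x 0 0))
      simp only [hI1, hB1, hG1_x0]
    · show I2 x = D2 x - (G1 (Function.update x 1 1) - G1 (Function.update x 1 0))
      simp only [hI2, hB2, hG1_x1]
  · -- `Σ integrands = γ (p′/p − q′/q) − leftovers`: `D₀ + D₁ + D₂ = γ (p′/p − q′/q)`, and the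
    -- leftovers in ratio form
    rw [Fin.sum_univ_three, swapTr_ratio (x 2) (hQne x hx), swapTr_ratio (x 2) (hQne x hx),
      swapTr_ratio (x 2) (hqpos 1 h1I).ne', swapTr_ratio (x 2) (hqpos 0 h0I).ne']
    show D0 x + I1 x + I2 x = _
    simp only [hD0, hI1, hI2, hD1, hD2, hB1, hB2]
    ring

end Summit.KontsevichZagierPeriods.KontsevichZagierPeriods.Cruxes.StokesGeneration.FibrewiseStokes
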